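import Summits.BirchSwinnertonDyer.BirchSwinnertonDyer.Theses.PrintX8VSC
import Summits.BirchSwinnertonDyer.BirchSwinnertonDyer.Theorems.SignedLowerHalvesSprungLowerDivisibilityAtThreeIotaDoorContraClosedOfThm714
import Summits.BirchSwinnertonDyer.BirchSwinnertonDyer.Theorems.SignedLowerHalvesSprungLowerDivisibilityAtThreeIotaDoorContraClosedOfPTMatar
import HarnessLib

/-!
# Line `iota-door-contra` for crux `PrintX8VSC.CyclotomicLowerPosLevelGivenHeldX8Contra` (C′ = item stmt-BirchSwinnertonDyer-23733, route
# `PrintX8VSC`, OPEN rev 4; guard = thm714 → thm716_contra → period3 → `HeldFactsIotaDoorX8Contra` (PT ∧ Kato 12.4 ∧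
# Matar)) — skeleton v4 (LEAD g10, 2026-08-28; v1–v3 = LEAD g7, sha16 9c6f9604f07976e4 registered on 23733): K-FORM DOOR at the
# positive-level cyclotomic primes (`ι𝔭 = 𝔭`), PROVED from TWO of the pack's facts {PT functional model, Matar 1.1} + the guard's Thm 7.14
# (LEAD g9 p678813 over w3 g10 p677954 — Kato 2004 Thm 12.4 is no longer an input of the door; the composition passes `hF.1 hF.2.2`);
# stub UNCHANGED (positive-level cyclotomic primes are `ι`-fixed, so w2 g12's orbit form adds only `1 ≤ k`, already implied by `j < k`);
# conversion to the crux's `D′`-form by the contragredient four-term identity; ONE research stub (`stub_iotaResidueCyclotomicContra`, K-form);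
# the x8 birth skeleton's `m`-form door is recorded as a fact-free theorem (`iotaDoorMFormContra`) and NOT used

Written by the LEAD of the parent crux 19875 `SprungLowerDivisibilityAtThree` (line `chromatic-common-zeros`, lead g7, 2026-08-28), for the
print-keyed twin route PrintX8VSC (director-bsd (288)(a) GO 2026-08-28T22:02:56Z). NOTHING HERE PROVES ANYTHING NEW: the crux C′, its γ-keyed
parents 22901/23401, K1, leaf X8 and BSD are NOT proved; the door's inputs (PT functional model, Matar 1.1 — two of the three conjuncts of
the held pack `HeldFactsIotaDoorX8Contra`, item 23731 — and Sprung Thm 7.14 = the guard's `h714`) are PUBLISHED theorems typed statement-only in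
`Literature/` and enter through the crux's own guard.

WHY A K-FORM DOOR (and not the x8 birth skeleton's `m`-form dichotomy `ℓ_𝔭 Λ/(G) ≤ min_• ℓ_{ι𝔭}(Λ/range Col^•)`): at a height-one `𝔭` the
contragredient four-term identity `ℓ_𝔭 D′.X + k(𝔭) = x′(𝔭) + m^•(𝔭)` (`SharpFlatColemanKatoDataContra.lengthAt_add_eq`, LEAD g6 p668614;
`k = ℓ_𝔭(I.H ⧸ Cs.Z)`, `x′ = ℓ_𝔭 Y′.X`, `m^• = ℓ_𝔭 Λ/(G)`) makes the crux's inequality `m^• ≤ ℓ_𝔭 D′.X` EQUIVALENT to Kato's fine inequality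
`k ≤ x′` (w3 g9 `ChromaticCommonZeros.cyclotomicLowerPosLevel_contra_of_katoFineLowerAt`, p671662). Since `m^• = k + c^• ≥ k + j`, the
`m`-form door `m^• ≤ j` forces `k = 0` and its residue `j < m^•` contains EVERY prime with `k ≥ 1` OR `c^• > j`; the K-form door
`k(𝔭) ≤ j(𝔭)` (positive-level cyclotomic primes are `ι`-fixed: `ChromaticCommonZeros.comap_invol_eq_self_of_cyclotomic_comp_mem`) is closed by
the Contra F-α♮ telescope `j(𝔭) ≤ x′(𝔭)` and leaves the strictly smaller residue `j(𝔭) < k(𝔭)` — in particular every cyclotomic common zero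
with vanishing zeta index is INSIDE the door (free), whatever the local indices.

THE LINE: C′ (D′-form) ⟸ «`k ≤ x′` at every positive-level cyclotomic common zero» (`cyclotomicLowerPosLevel_contra_of_katoFineLowerAt`)
⟸ DOOR `k ≤ j` (theorem `iotaDoorCyclotomicContra` = `ChromaticCommonZeros.iotaDoorContra_posLevel_of_poitouTate_of_matar_of_thm714`, LEAD g9 p678813: `katoFineLowerAt_of_iotaDoor_contra_of_comap_invol_eq` (w3 g9 p670914) ∘
`cokerBoundIotaOffT_contra_of_poitouTate_of_thm714'` (w3 g10 p677954) — Poitou–Tate functional model + Matar 1.1 + the guard's Thm 7.14 (𝐇¹ ↪ Λ via Col♯ and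
UFD 𝔭-local cyclicity replace Kato Thm 12.4); its three-fact sibling is `…_posLevel_of_heldPack_of_thm714`, LEAD g7 p675240, and its four-fact sibling with
Kato fine torsion is `ChromaticCommonZeros.iotaDoorContra_posLevel_of_printedFacts`, LEAD g7 p674090) ∨ RESIDUE
`j < k` (stub `stub_iotaResidueCyclotomicContra` = the Eisenstein (⊆) half of Sprung 2012 Main Conj. 7.21 / Kato Conj. 12.10 at the exceptional
twisted zeros `L(E, χ, 1) = 0`, `cond χ = 3^{j+1}`, with deficient local index; OPEN in print at `(3, a₃ = ±3)`; Rohrlich-finite per curve, none on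
the 217-cell census to level `n ≤ 6`).
Registered stubs: ONE — `stub_iotaResidueCyclotomicContra` (research). Composition `CyclotomicLowerPosLevelGivenHeldX8Contra_of` closes the crux
BY NAME. (`iotaDoorMFormContra`, the x8 birth skeleton's `m`-form door, is a fact-free theorem here — `ChromaticCommonZeros.cyclotomicDoorMForm_contra`,
LEAD g7 p674090 — and NOT used by the composition: its residue would be `{j < m}` ⊋ `{j < k}`.)
[cite: Sprung2012, Thm. 7.14 (3) (p. 1504), Prop. 7.19 and Main Conj. 7.21 (p. 1505)] [cite: Kato2004Asterisque, Thm. 12.4 (p. 221), Conj. 12.10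
(p. 224), (17.13.1) (p. 279–280)] [cite: Matar2020, Thm. 1.1] [cite: Kobayashi2003, Prop. 7.1, Thm. 7.3] [cite: Rohrlich1984, Thm.]
-/

set_option linter.dupNamespace false
set_option autoImplicit false

noncomputable section

open scoped Classical NumberField MatrixGroups ModularForm

open NumberField IsDedekindDomain CongruenceSubgroup WeierstrassCurve Field
  Literature.NumberTheory.EllipticCurves Literature.NumberTheory.EllipticCurves.ModularForms
  Literature.NumberTheory.EllipticCurves.ZpExtension Literature.NumberTheory.EllipticCurves.Sprung2017
  Literature.NumberTheory.EllipticCurves.Sprung2012 Literature.NumberTheory.EllipticCurves.Rank1Residual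
  Literature.NumberTheory.EllipticCurves.IwasawaAlgebra Literature.NumberTheory.EllipticCurves.Kato2004
  Literature.NumberTheory.EllipticCurves.Module
  Summit.BirchSwinnertonDyer.BirchSwinnertonDyer.Theorems


namespace Summit.BirchSwinnertonDyer.BirchSwinnertonDyer.Cruxes.CyclotomicLowerPosLevelGivenHeldX8Contra.IotaDoorContra

/-! ## The ONE stub: the research residue at the positive-level cyclotomic primes (K-form) -/

/-- **stub ι-RESIDUE at the positive-level cyclotomic primes (print currency, K-form)** behind the three held facts + the ι-door pack
`HeldFactsIotaDoorX8Contra` (Sprung Thm 7.14, Thm 7.16 print-keyed `_contra`, period unit at 3; PT functional model, Kato 12.4, Matar 1.1 —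
the same binders as the K′ residue stub on item 23732): over the crux's arithmetic binders, the contragredient joint package `I, Cs, Cf`
(`Cs.Z = Cf.Z`) and a natural-keyed fine dual datum `Y′ : FineSelmerDualData κ γ⁻¹`, at a height-one `𝔭` with `T ∉ 𝔭 ∋ Φ_{3^j}(1+T)`
(`j ≥ 1`; such `𝔭` is `ι`-fixed and `3 ∉ 𝔭`) that is a common zero of both Néron-normalised colours and lies OUTSIDE the door —
`min_• ℓ_𝔭(Λ ⧸ range C•.colMap) < ℓ_𝔭(I.H ⧸ Cs.Z)` (Kato's local index deficient relative to the zeta index) —, Kato's fine inequality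
`ℓ_𝔭(I.H ⧸ Cs.Z) ≤ ℓ_𝔭 Y′.X`. Equivalent there (four-term identity) to the crux's `ℓ_𝔭 Λ/(G) ≤ ℓ_𝔭 D′.X` = the Eisenstein (⊆) half of
Sprung 2012 Main Conj. 7.21 / Kato 2004 Conj. 12.10 at the exceptional twisted zeros `L(E, χ, 1) = 0`, `cond χ = 3^{j+1}` — OPEN in print at
`(3, a₃ = ±3)` (BSTW 2024 needs `a_p = 0`; Kim needs `p ≥ 5`; Lei–Sujatha 2021 Thm 1.2 assumes Kato's IMC); Rohrlich-finite per curve, no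
instance on the 217-cell census to level `n ≤ 6`. With the binders in scope: `h716c.invol_rational` (print upper bound on the γ⁻¹-keyed
duals), Kato's `x′ ≤ k`, the defect element `j_def` (`k = x′ + ℓ(Λ/j_def)`): the stub ⟺ «`j_def` has no positive-level cyclotomic prime
factor inside `{j < k}`». Research, L/XL. Why it might fail: only through a failure of the signed main conjecture at such a twisted zero of an
X8 curve. [cite: Sprung2012, Thm. 7.16 (p. 1504), Prop. 7.19 and Main Conj. 7.21 (p. 1505)] [cite: Kato2004Asterisque, Conj. 12.10 (p. 224),
Thm. 12.5 (p. 222)] [cite: Rohrlich1984, Thm.] [cite: LeiSujatha2021, Thm. 1.2] -/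
theorem stub_iotaResidueCyclotomicContra :
    thm714_sharpFlatSelmerDual_finite_torsion → thm716_sharpFlatCharIdeal_divisibility_contra →
    realPeriodRat_eq_unit_mul_plusPeriod_three →
    Summit.BirchSwinnertonDyer.BirchSwinnertonDyer.Theses.PrintX8VSC.HeldFactsIotaDoorX8Contra →
    ∀ (W : WeierstrassCurve ℚ) [W.IsElliptic] [W.IsGloballyMinimal] (p : ℕ) [Fact p.Prime]
      [ContinuousSMul ℤ_[p] (W.tateModule p)] [Module.Free ℤ_[p] (W.tateModule p)]
      [Module.Finite ℤ_[p] (W.tateModule p)],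
      ClassX8 W p → ∀ (κ : ZpExtension ℚ p) (γ : Field.absoluteGaloisGroup ℚ),
      κ.IsCyclotomic → κ.IsTopGenerator γ → IsCyclotomicVariable p γ →
    ∀ (v : HeightOneSpectrum (𝓞 ℚ)), (p : 𝓞 ℚ) ∈ v.asIdeal →
    ∀ (g : Field.absoluteGaloisGroup (v.adicCompletion ℚ)),
      κ.IsTopGenerator (resGalOfEmb (closureEmb (K := ℚ) (v.adicCompletion ℚ)) g) →
    ∀ (cneg : localPoints W (v.adicCompletion ℚ)) (c : ℕ → localPoints W (v.adicCompletion ℚ)),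
      IsHondaSystem κ (closureEmb (K := ℚ) (v.adicCompletion ℚ)) W (W.frobeniusTrace p) g cneg c →
    ∀ (N : ℕ) (_ : NeZero N) (f : CuspForm (Gamma0 N) 2) (ϖ : ℚ) (Lsharp Lflat : IwasawaAlgebra p),
      IsNewformOf W f → (ϖ : ℝ) * W.realPeriodRat = plusPeriod f →
      IsSprungPair f p (W.frobeniusTrace p) Lsharp Lflat →
    ∀ (I : Kato2004.IwasawaH1Data W p κ γ)
      (Cs : SharpFlatColemanKatoDataContra W p f ϖ κ γ (closureEmb (K := ℚ) (v.adicCompletion ℚ))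
        (W.frobeniusTrace p) g c Chroma.sharp I)
      (Cf : SharpFlatColemanKatoDataContra W p f ϖ κ γ (closureEmb (K := ℚ) (v.adicCompletion ℚ))
        (W.frobeniusTrace p) g c Chroma.flat I),
      Cs.Z = Cf.Z →
    ∀ (Y : W.FineSelmerDualData κ γ⁻¹) (𝔭 : PrimeSpectrum (IwasawaAlgebra p)), 𝔭.asIdeal.height = 1 →
      (PowerSeries.X : IwasawaAlgebra p) ∉ 𝔭.asIdeal →
      (∃ j : ℕ, 1 ≤ j ∧
        ((((Polynomial.cyclotomic (p ^ j) ℤ).comp (Polynomial.X + 1)).map (Int.castRingHom ℤ_[p]) : Polynomial ℤ_[p]) :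
          PowerSeries ℤ_[p]) ∈ 𝔭.asIdeal) →
      (∀ (col' : Chroma) (G' : IwasawaAlgebra p),
        iwasawaToPowerSeries p G' =
          PowerSeries.C (ϖ : ℚ_[p]) * iwasawaToPowerSeries p (chromaticL col' Lsharp Lflat) →
        G' ∈ 𝔭.asIdeal) →
      min (Module.lengthAt (IwasawaAlgebra p) (IwasawaAlgebra p ⧸ LinearMap.range Cs.colMap) 𝔭)
          (Module.lengthAt (IwasawaAlgebra p) (IwasawaAlgebra p ⧸ LinearMap.range Cf.colMap) 𝔭) <
          Module.lengthAt (IwasawaAlgebra p) (I.H ⧸ Cs.Z) 𝔭 →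
      Module.lengthAt (IwasawaAlgebra p) (I.H ⧸ Cs.Z) 𝔭 ≤ Module.lengthAt (IwasawaAlgebra p) Y.X 𝔭 := by
  sorry

/-! ## The K-form door at the positive-level cyclotomic primes, PROVED from {PT functional model, Matar 1.1} + the guard's Thm 7.14 -/

/-- **THE K-FORM DOOR AT A POSITIVE-LEVEL CYCLOTOMIC PRIME, from TWO of the held pack's inputs and the guard's Thm 7.14** (PT functional
model, Matar 1.1; `h714` supplies the fine dual's torsion on X8 and `𝐇¹ ≠ 0`; Kato 12.4 is no longer an input — w3 g10 p677954): over the same binders as the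
residue stub, at a height-one `𝔭` with `T ∉ 𝔭 ∋ Φ_{3^j}(1+T)` (`j ≥ 1`), common zero of both normalised colours, INSIDE the door
`ℓ_𝔭(I.H ⧸ Cs.Z) ≤ min_• ℓ_𝔭(Λ ⧸ range C•.colMap)`: `ℓ_𝔭(I.H ⧸ Cs.Z) ≤ ℓ_𝔭 Y′.X`. Proof = LEAD g9 p678813
`ChromaticCommonZeros.iotaDoorContra_posLevel_of_poitouTate_of_matar_of_thm714`: `𝔭` is `ι`-fixed and `3 ∉ 𝔭`; the primed Contra F-α♮′
telescope at `𝔭` (`ChromaticCommonZeros.cokerBoundIotaOffT_contra_of_poitouTate_of_thm714'`, w3 g10 p677954) reads `j(𝔭) ≤ x′(ι𝔭) = x′(𝔭)`;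
compose (`ChromaticCommonZeros.katoFineLowerAt_of_iotaDoor_contra_of_comap_invol_eq`, w3 g9 p670914).
[cite: Kato2004Asterisque, (17.13.1) (p. 279–280)] [cite: Sprung2012, Thm. 7.14 (3) (p. 1504)] [cite: Matar2020, Thm. 1.1]
[cite: Kobayashi2003, Prop. 7.1, Thm. 7.3 (pp. 12–13)] [cite: Wingberg1989, Cor. 2.5] -/
theorem iotaDoorCyclotomicContra (hPT : thm714seq_sharpFlat_poitouTate_functionalModel)
    (hMatar : matar2020_thm11_selmerDualTorsion_pseudoIso_fineSelmerDual) (h714 : thm714_sharpFlatSelmerDual_finite_torsion) :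
    ∀ (W : WeierstrassCurve ℚ) [W.IsElliptic] [W.IsGloballyMinimal] (p : ℕ) [Fact p.Prime]
      [ContinuousSMul ℤ_[p] (W.tateModule p)] [Module.Free ℤ_[p] (W.tateModule p)]
      [Module.Finite ℤ_[p] (W.tateModule p)],
      ClassX8 W p → ∀ (κ : ZpExtension ℚ p) (γ : Field.absoluteGaloisGroup ℚ),
      κ.IsCyclotomic → κ.IsTopGenerator γ → IsCyclotomicVariable p γ →
    ∀ (v : HeightOneSpectrum (𝓞 ℚ)), (p : 𝓞 ℚ) ∈ v.asIdeal →
    ∀ (g : Field.absoluteGaloisGroup (v.adicCompletion ℚ)),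
      κ.IsTopGenerator (resGalOfEmb (closureEmb (K := ℚ) (v.adicCompletion ℚ)) g) →
    ∀ (cneg : localPoints W (v.adicCompletion ℚ)) (c : ℕ → localPoints W (v.adicCompletion ℚ)),
      IsHondaSystem κ (closureEmb (K := ℚ) (v.adicCompletion ℚ)) W (W.frobeniusTrace p) g cneg c →
    ∀ (N : ℕ) (_ : NeZero N) (f : CuspForm (Gamma0 N) 2) (ϖ : ℚ) (Lsharp Lflat : IwasawaAlgebra p),
      IsNewformOf W f → (ϖ : ℝ) * W.realPeriodRat = plusPeriod f →
      IsSprungPair f p (W.frobeniusTrace p) Lsharp Lflat →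
    ∀ (I : Kato2004.IwasawaH1Data W p κ γ)
      (Cs : SharpFlatColemanKatoDataContra W p f ϖ κ γ (closureEmb (K := ℚ) (v.adicCompletion ℚ))
        (W.frobeniusTrace p) g c Chroma.sharp I)
      (Cf : SharpFlatColemanKatoDataContra W p f ϖ κ γ (closureEmb (K := ℚ) (v.adicCompletion ℚ))
        (W.frobeniusTrace p) g c Chroma.flat I),
      Cs.Z = Cf.Z →
    ∀ (Y : W.FineSelmerDualData κ γ⁻¹) (𝔭 : PrimeSpectrum (IwasawaAlgebra p)), 𝔭.asIdeal.height = 1 →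
      (PowerSeries.X : IwasawaAlgebra p) ∉ 𝔭.asIdeal →
      (∃ j : ℕ, 1 ≤ j ∧
        ((((Polynomial.cyclotomic (p ^ j) ℤ).comp (Polynomial.X + 1)).map (Int.castRingHom ℤ_[p]) : Polynomial ℤ_[p]) :
          PowerSeries ℤ_[p]) ∈ 𝔭.asIdeal) →
      (∀ (col' : Chroma) (G' : IwasawaAlgebra p),
        iwasawaToPowerSeries p G' =
          PowerSeries.C (ϖ : ℚ_[p]) * iwasawaToPowerSeries p (chromaticL col' Lsharp Lflat) →
        G' ∈ 𝔭.asIdeal) →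
      Module.lengthAt (IwasawaAlgebra p) (I.H ⧸ Cs.Z) 𝔭 ≤
          min (Module.lengthAt (IwasawaAlgebra p) (IwasawaAlgebra p ⧸ LinearMap.range Cs.colMap) 𝔭)
            (Module.lengthAt (IwasawaAlgebra p) (IwasawaAlgebra p ⧸ LinearMap.range Cf.colMap) 𝔭) →
      Module.lengthAt (IwasawaAlgebra p) (I.H ⧸ Cs.Z) 𝔭 ≤ Module.lengthAt (IwasawaAlgebra p) Y.X 𝔭 :=
  ChromaticCommonZeros.iotaDoorContra_posLevel_of_poitouTate_of_matar_of_thm714 hPT hMatar h714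

/-- **`k ≤ x′` at every positive-level cyclotomic common zero ⟸ the guard (three held facts ∧ ι-door pack) ∧ the residue stub** (door ∨
residue, `le_or_gt` on `ℕ∞`): the hypothesis of `ChromaticCommonZeros.cyclotomicLowerPosLevel_contra_of_katoFineLowerAt` VERBATIM. -/
theorem katoFineLowerPosLevelContra_of_stub (h714 : thm714_sharpFlatSelmerDual_finite_torsion)
    (h716c : thm716_sharpFlatCharIdeal_divisibility_contra) (h3 : realPeriodRat_eq_unit_mul_plusPeriod_three)
    (hF : Summit.BirchSwinnertonDyer.BirchSwinnertonDyer.Theses.PrintX8VSC.HeldFactsIotaDoorX8Contra) :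
    ∀ (W : WeierstrassCurve ℚ) [W.IsElliptic] [W.IsGloballyMinimal] (p : ℕ) [Fact p.Prime]
      [ContinuousSMul ℤ_[p] (W.tateModule p)] [Module.Free ℤ_[p] (W.tateModule p)]
      [Module.Finite ℤ_[p] (W.tateModule p)],
      ClassX8 W p → ∀ (κ : ZpExtension ℚ p) (γ : Field.absoluteGaloisGroup ℚ),
      κ.IsCyclotomic → κ.IsTopGenerator γ → IsCyclotomicVariable p γ →
    ∀ (v : HeightOneSpectrum (𝓞 ℚ)), (p : 𝓞 ℚ) ∈ v.asIdeal →
    ∀ (g : Field.absoluteGaloisGroup (v.adicCompletion ℚ)),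
      κ.IsTopGenerator (resGalOfEmb (closureEmb (K := ℚ) (v.adicCompletion ℚ)) g) →
    ∀ (cneg : localPoints W (v.adicCompletion ℚ)) (c : ℕ → localPoints W (v.adicCompletion ℚ)),
      IsHondaSystem κ (closureEmb (K := ℚ) (v.adicCompletion ℚ)) W (W.frobeniusTrace p) g cneg c →
    ∀ (N : ℕ) (_ : NeZero N) (f : CuspForm (Gamma0 N) 2) (ϖ : ℚ) (Lsharp Lflat : IwasawaAlgebra p),
      IsNewformOf W f → (ϖ : ℝ) * W.realPeriodRat = plusPeriod f →
      IsSprungPair f p (W.frobeniusTrace p) Lsharp Lflat →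
    ∀ (I : Kato2004.IwasawaH1Data W p κ γ)
      (Cs : SharpFlatColemanKatoDataContra W p f ϖ κ γ (closureEmb (K := ℚ) (v.adicCompletion ℚ))
        (W.frobeniusTrace p) g c Chroma.sharp I)
      (Cf : SharpFlatColemanKatoDataContra W p f ϖ κ γ (closureEmb (K := ℚ) (v.adicCompletion ℚ))
        (W.frobeniusTrace p) g c Chroma.flat I),
      Cs.Z = Cf.Z →
    ∀ (Y : W.FineSelmerDualData κ γ⁻¹) (𝔭 : PrimeSpectrum (IwasawaAlgebra p)), 𝔭.asIdeal.height = 1 →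
      (PowerSeries.X : IwasawaAlgebra p) ∉ 𝔭.asIdeal →
      (∃ j : ℕ, 1 ≤ j ∧
        ((((Polynomial.cyclotomic (p ^ j) ℤ).comp (Polynomial.X + 1)).map (Int.castRingHom ℤ_[p]) : Polynomial ℤ_[p]) :
          PowerSeries ℤ_[p]) ∈ 𝔭.asIdeal) →
      (∀ (col' : Chroma) (G' : IwasawaAlgebra p),
        iwasawaToPowerSeries p G' =
          PowerSeries.C (ϖ : ℚ_[p]) * iwasawaToPowerSeries p (chromaticL col' Lsharp Lflat) →
        G' ∈ 𝔭.asIdeal) →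
      Module.lengthAt (IwasawaAlgebra p) (I.H ⧸ Cs.Z) 𝔭 ≤ Module.lengthAt (IwasawaAlgebra p) Y.X 𝔭 := by
  intro W _ _ p _ _ _ _ hX κ γ hκ hγ hcv v hv g hg cneg c hH N hN f ϖ Lsharp Lflat hf hϖ hSP I Cs Cf hZ Y 𝔭 h𝔭 hT hΦ hcommon
  rcases le_or_gt (Module.lengthAt (IwasawaAlgebra p) (I.H ⧸ Cs.Z) 𝔭)
      (min (Module.lengthAt (IwasawaAlgebra p) (IwasawaAlgebra p ⧸ LinearMap.range Cs.colMap) 𝔭)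
        (Module.lengthAt (IwasawaAlgebra p) (IwasawaAlgebra p ⧸ LinearMap.range Cf.colMap) 𝔭)) with hle | hlt
  · exact iotaDoorCyclotomicContra hF.1 hF.2.2 h714 W p hX κ γ hκ hγ hcv v hv g hg cneg c hH N hN f ϖ Lsharp Lflat hf
      hϖ hSP I Cs Cf hZ Y 𝔭 h𝔭 hT hΦ hcommon hle
  · exact stub_iotaResidueCyclotomicContra h714 h716c h3 hF W p hX κ γ hκ hγ hcv v hv g hg cneg c hH N hN f ϖ Lsharp Lflat hf hϖ
      hSP I Cs Cf hZ Y 𝔭 h𝔭 hT hΦ hcommon hlt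

/-! ## The x8 birth skeleton's `m`-form door (fact-free; recorded, NOT used) -/

/-- **The x8 birth skeleton's `m`-FORM DOOR for C′, FACT-FREE — and why the line does not use it** (= `ChromaticCommonZeros.cyclotomicDoorMForm_contra`,
LEAD g7 p674090): inside `ℓ_𝔭 Λ/(G) ≤ min_• ℓ_{ι𝔭}(Λ ⧸ range C•.colMap)` at a positive-level cyclotomic `𝔭` the content identity `m^• = k + c^•`
forces `k(𝔭) = 0`, whence `m^• ≤ ℓ_𝔭 D′.X` by the four-term identity; its complement `{j < m}` would put every cyclotomic common zero with
positive zeta index in the residue, so the line registers the K-form door `iotaDoorCyclotomicContra` (residue `{j < k}`) instead.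
[cite: Sprung2012, Def. 6.1 (p. 1495), Thm. 7.14 (3) (p. 1504), Prop. 7.19 (p. 1505)] [cite: Kato2004Asterisque, Thm. 12.5 (p. 222), §17.13 (p. 280)] -/
theorem iotaDoorMFormContra :
    ∀ (W : WeierstrassCurve ℚ) [W.IsElliptic] [W.IsGloballyMinimal] (p : ℕ) [Fact p.Prime]
      [ContinuousSMul ℤ_[p] (W.tateModule p)] [Module.Free ℤ_[p] (W.tateModule p)]
      [Module.Finite ℤ_[p] (W.tateModule p)],
      ClassX8 W p → ∀ (col : Chroma) (κ : ZpExtension ℚ p) (γ : Field.absoluteGaloisGroup ℚ),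
      κ.IsCyclotomic → κ.IsTopGenerator γ → IsCyclotomicVariable p γ →
    ∀ (v : HeightOneSpectrum (𝓞 ℚ)), (p : 𝓞 ℚ) ∈ v.asIdeal →
    ∀ (g : Field.absoluteGaloisGroup (v.adicCompletion ℚ)),
      κ.IsTopGenerator (resGalOfEmb (closureEmb (K := ℚ) (v.adicCompletion ℚ)) g) →
    ∀ (cneg : localPoints W (v.adicCompletion ℚ)) (c : ℕ → localPoints W (v.adicCompletion ℚ)),
      IsHondaSystem κ (closureEmb (K := ℚ) (v.adicCompletion ℚ)) W (W.frobeniusTrace p) g cneg c →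
    ∀ (N : ℕ) (_ : NeZero N) (f : CuspForm (Gamma0 N) 2) (ϖ : ℚ) (Lsharp Lflat : IwasawaAlgebra p),
      IsNewformOf W f → (ϖ : ℝ) * W.realPeriodRat = plusPeriod f →
      IsSprungPair f p (W.frobeniusTrace p) Lsharp Lflat → chromaticL col Lsharp Lflat ≠ 0 →
    ∀ (D : SharpFlatSelmerDualData W κ γ⁻¹ (closureEmb (K := ℚ) (v.adicCompletion ℚ))
        (W.frobeniusTrace p) g c col) [Module.Finite (IwasawaAlgebra p) D.X],
      Module.IsTorsion (IwasawaAlgebra p) D.X →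
    ∀ (G : IwasawaAlgebra p),
      iwasawaToPowerSeries p G =
        PowerSeries.C (ϖ : ℚ_[p]) * iwasawaToPowerSeries p (chromaticL col Lsharp Lflat) →
    ∀ (I : Kato2004.IwasawaH1Data W p κ γ)
      (Cs : SharpFlatColemanKatoDataContra W p f ϖ κ γ (closureEmb (K := ℚ) (v.adicCompletion ℚ))
        (W.frobeniusTrace p) g c Chroma.sharp I)
      (Cf : SharpFlatColemanKatoDataContra W p f ϖ κ γ (closureEmb (K := ℚ) (v.adicCompletion ℚ))
        (W.frobeniusTrace p) g c Chroma.flat I),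
      Cs.Z = Cf.Z →
    ∀ 𝔭 : PrimeSpectrum (IwasawaAlgebra p), 𝔭.asIdeal.height = 1 →
      (PowerSeries.X : IwasawaAlgebra p) ∉ 𝔭.asIdeal →
      (∃ j : ℕ, 1 ≤ j ∧
        ((((Polynomial.cyclotomic (p ^ j) ℤ).comp (Polynomial.X + 1)).map (Int.castRingHom ℤ_[p]) : Polynomial ℤ_[p]) :
          PowerSeries ℤ_[p]) ∈ 𝔭.asIdeal) →
      (∀ (col' : Chroma) (G' : IwasawaAlgebra p),
        iwasawaToPowerSeries p G' =
          PowerSeries.C (ϖ : ℚ_[p]) * iwasawaToPowerSeries p (chromaticL col' Lsharp Lflat) →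
        G' ∈ 𝔭.asIdeal) →
      Module.lengthAt (IwasawaAlgebra p) (IwasawaAlgebra p ⧸ Ideal.span {G}) 𝔭 ≤
          min (Module.lengthAt (IwasawaAlgebra p) (IwasawaAlgebra p ⧸ LinearMap.range Cs.colMap)
                (PrimeSpectrum.comap (invol p).toRingHom 𝔭))
            (Module.lengthAt (IwasawaAlgebra p) (IwasawaAlgebra p ⧸ LinearMap.range Cf.colMap)
                (PrimeSpectrum.comap (invol p).toRingHom 𝔭)) →
      Module.lengthAt (IwasawaAlgebra p) (IwasawaAlgebra p ⧸ Ideal.span {G}) 𝔭 ≤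
        Module.lengthAt (IwasawaAlgebra p) D.X 𝔭 :=
  ChromaticCommonZeros.cyclotomicDoorMForm_contra

/-! ## The composition (sorry-free): crux C′ BY NAME -/

/-- **THE SKELETON**: the crux decl `PrintX8VSC.CyclotomicLowerPosLevelGivenHeldX8Contra` (item 23733) BY NAME — the `D′`-form from the K-form at every
positive-level cyclotomic common zero (`ChromaticCommonZeros.cyclotomicLowerPosLevel_contra_of_katoFineLowerAt`, the contragredient four-term
identity), the K-form from door ∨ residue. -/
theorem CyclotomicLowerPosLevelGivenHeldX8Contra_of :
    Summit.BirchSwinnertonDyer.BirchSwinnertonDyer.Theses.PrintX8VSC.CyclotomicLowerPosLevelGivenHeldX8Contra := by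
  intro h714 h716c h3 hF
  exact ChromaticCommonZeros.cyclotomicLowerPosLevel_contra_of_katoFineLowerAt (katoFineLowerPosLevelContra_of_stub h714 h716c h3 hF)

end Summit.BirchSwinnertonDyer.BirchSwinnertonDyer.Cruxes.CyclotomicLowerPosLevelGivenHeldX8Contra.IotaDoorContra

end
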